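import Literature.Computability.QuantumComplexity.OracleSeparations
import Literature.Computability.QuantumComplexity.AaronsonAmbainis
import Literature.Computability.Complexity.Counting
import Literature.Computability.Complexity.PolyTimeCountable
import HarnessLib

/-!
# Aaronson–Ambainis 2014, Thm. 23: the efficient-simulation claim (apx) of its proof (documentation) and the countability of the uniform families

S. Aaronson, A. Ambainis, *The need for structure in quantum speedups*, Theory Comput. 10 (2014)
(arXiv:0911.0996v3) [AaronsonAmbainis2014], **Theorem 23** (= Thm. 7 (iii); p. 14): "Suppose
Conjecture 6 holds. Then `P = P^{#P}` implies `BQP^A ⊂ AvgP^A` with probability `1` for a random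
oracle `A`." The theorem itself is the tree fact
`Literature.Barriers.QuantumAdvantage.aaronsonAmbainis2014_thm7iii` (`RandomOracleMethod.lean`).
Its proof has two halves:

1. **Claim (apx)** (p. 14): "Assume Conjecture 6 as well as `P = P^{#P}`. Then we claim that
   there exists a deterministic polynomial-time algorithm `C` such that for all `Q` and
   `x ∈ {0,1}ⁿ`, `Pr_A[|p̃_x(A) − p_x(A)| > 1/10] < 1/n³`, where `p̃_x(A)` is the output of `C`
   given input `x` and oracle `A`" — `Q` a polynomial-time quantum Turing machine querying `A`,
   `p_x(A) = Pr[Q^A(x) accepts]`; "we can implement `C` using not only `poly(n)` queries to `A`,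
   but also `poly(n)` computation steps" (the algorithm of Thm. 21 run on the acceptance
   polynomial of Lemma 20, its coefficients computed in `P^{#P}`, the other quantities in the
   counting hierarchy, which collapses to `P` under `P = P^{#P}`). This is the deep half (it
   needs the polynomial method for quantum oracle machines, Conjecture 6 through Thm. 21, and
   the `#P` machinery). It is an internal claim of the proof of Thm. 23, not a separately
   citable result, so (D-0026) it is **not a named fact**: its query-complexity part is PROVED
   (`measure_simTreeOn_threshold_lt`, `AaronsonAmbainisThm23Queries.lean`), the reduction of the
   whole claim to the polynomial-time implementability of the simulation trees is PROVED
   (`aaronsonAmbainis2014_thm23_apx_of_dyadicMachines`, `AaronsonAmbainisThm23Reduction.lean`,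
   whose conclusion spells the claim out in the rendering below), and the claim enters the
   other half as the explicit hypothesis of
   `Literature.Barriers.QuantumAdvantage.aaronsonAmbainis2014_thm7iii_of_apx`.
2. The probabilistic half ("Now let `δ_n(A)` be the fraction of inputs … Markov … Since
   `Σ 1/n²` converges … with probability `1` over `A` … Since the number of `BQP^A` languages is
   countable …"), which is PROVED in `Barriers/QuantumAdvantage/RandomOracleMethodThm23.lean`
   (`ae_BQPRel_subset_AvgPRel_of_apxMachines`, `aaronsonAmbainis2014_thm7iii_of_apx`), together
   with the countability of the polynomial-time uniform quantum circuit families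
   (`countable_setOf_isUniform`, this file).

**The rendering of (apx)** (the hypothesis of `aaronsonAmbainis2014_thm7iii_of_apx` = the
conclusion of `aaronsonAmbainis2014_thm23_apx_of_dyadicMachines`). Over the tree's models — `Q` =
a polynomial-time uniform family of Clifford+T circuits with oracle gates
(`QCircuitFamily cliffordT`, `IsUniform`, acceptance probability `acceptProbOn A x`, exactly the
data of `BQPRel A`); `C` = a polynomial-time classical oracle machine in G01's transcript model
(`OracleAlg Bool`, `IsPolyTime`, a polynomial bounding rounds and query lengths, run against
`Oracle.ofLanguage A`); `Pr_A` = `randomOracleMeasure` — the CONSEQUENCE of the printed claim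
that the proof of Thm. 23 uses (thresholding the estimate at `1/2`, as in the proof of Cor. 22:
"Output `f(X) = 1` if `p̃(X) ≥ 1/2`"): assuming Conjecture 6 (`AAConjecture`) and `P = P^{#P}`,
for each such `Q` (the printed `C` is uniform in `Q`; per-`Q` is weaker) there is such a `C`
with Boolean output whose answer differs from `[p_x(A) ≥ 1/2]` on an input `x` of length `n ≥ 1`
satisfying the `BQP` promise (`p_x(A) ≥ 2/3` or `≤ 1/3`, where `|p̃ − p| ≤ 1/10` forces the right
threshold bit) only on a set of oracles of measure `< 1/n³`. (`n ≥ 1`: the printed bound `1/n³`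
is vacuous at `n = 0`.) A non-halting run within the budget counts as an error (the budget
polynomial is existentially quantified, so this costs nothing).

## References

* [AaronsonAmbainis2014] arXiv:0911.0996v3, read via `lit read arxiv:0911.0996`: Lemma 20, Thm. 21
  (p. 13), Cor. 22 and Thm. 23 with its proof (p. 14).
* E. Bernstein, U. Vazirani, *Quantum complexity theory*, SIAM J. Comput. 26 (1997), §8
  [BernsteinVazirani1997] (`BQP ⊆ P^{#P}` techniques cited in the proof).
-/

noncomputable section

namespace Literature.Computability.QuantumComplexity

open MeasureTheory _root_.Computability Literature.Computability.Complexity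
  Literature.Computability.Complexity.Classes Literature.Computability.Cryptography

/-- **The polynomial-time uniform quantum circuit families are countable** ("the number of `BQP^A`
languages is countable", proof of Thm. 23): a uniform family is determined by the function
`n ↦ ⟨n, ancillas n, circ n⟩`, which is polynomial-time computable with an injective output
encoding (`QCircuit.sigmaEncode_injective`), and there are countably many such functions
(`countable_setOf_polyTimeComputable`). [cite: AaronsonAmbainis2014, proof of Thm. 23 (p. 14)] -/
theorem countable_setOf_isUniform {G : QGateSet} [Encodable G.Op] :
    Set.Countable {F : QCircuitFamily G | F.IsUniform} := by
  have h := countable_setOf_polyTimeComputable (α := ℕ) (β := Σ n m : ℕ, QCircuit G (n + m))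
    unaryEncodeNat (eb := QCircuit.sigmaEncode) QCircuit.sigmaEncode_injective
  refine Set.MapsTo.countable_of_injOn
    (f := fun F : QCircuitFamily G => fun n =>
      (⟨n, F.ancillas n, F.circ n⟩ : Σ n m : ℕ, QCircuit G (n + m)))
    (fun F hF => hF) ?_ h
  rintro ⟨anc, circ⟩ - ⟨anc', circ'⟩ - hFF
  have hanc : anc = anc' := by
    funext n
    have := congrFun hFF n
    simp only [Sigma.mk.inj_iff, heq_eq_eq, true_and] at this
    exact this.1
  subst hanc
  congr
  funext n
  have := congrFun hFF n
  simp only [Sigma.mk.inj_iff, heq_eq_eq, true_and] at this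
  exact this

end Literature.Computability.QuantumComplexity

end
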